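import Mathlib
import HarnessLib

/-!
# ESS with `N_pf` pseudofermion draws: `ESS(N_pf) = ESS(∞) / (1 + C/N_pf)`

Topic `Probability/ImportanceSampling`.  PUBLISHED RESULT with our formalisation of the printed
derivation (finite sample spaces, population moments); no named fact is introduced.

Source: R. Abbott et al., *Gauge-equivariant flow models for sampling in lattice field theories
with pseudofermions*, Phys. Rev. D 106 (2022) 074506 [arXiv:2207.08945], §III.E "Improving the
stochastic determinant estimate" and Appendix A "ESS with multiple pseudofermion samples".

Setting (§III.E).  A joint flow model draws a gauge field `U ∼ q(U)` and, for fixed `U`, `N_pf`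
independent pseudofermion samples `φ⁽¹⁾, …, φ⁽ᴺ⁾ ∼ q(φ|U)`; the conditional weight
`w(φ|U) = p(φ|U)/q(φ|U)` has `⟨w⟩_{q(·|U)} = 1` and the averaged weight factors are
"`w_{N_pf}({φ}|U) = (1/N_pf) Σ_i p(φ⁽ⁱ⁾|U)/q(φ⁽ⁱ⁾|U)`" (eq. `condw`) and
"`w_{N_pf}(U) = (p(U)/q(U)) × w_{N_pf}({φ}|U)`".  The model quality is the asymptotic effective
sample size `ESS(N_pf)` = `⟨w⟩² / ⟨w²⟩` of this weight ("As a metric, one can also define the ESS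
for several pseudofermions", eq. for `ESS(N_pf)`), and the paper states: "As demonstrated in
App. A, this depends on the number of pseudofermion draws as
`ESS(N_pf) = ESS(∞) / (1 + C/N_pf)`, where `C` is a constant, and `ESS(∞)` coincides with the
marginal ESS" (eq. `ESSscalingNPF`).

Printed derivation (App. A).  "Asymptotically, `ESS⁻¹(N_pf) = ⟨w(U,{φ})²⟩_{q(U,{φ})}
≡ ∫dU q(U) w(U)² ε⁻¹_{N_pf}(U)`" with `ε⁻¹_{N_pf}(U) = ⟨w_{N_pf}({φ}|U)²⟩_{φ⁽¹⁾⋯φ⁽ᴺ⁾}`;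
"Using `⟨w⟩ = 1`, `ε⁻¹_{N_pf}(U) = (1/N_pf²)⟨Σ_i w_i² + Σ_{i≠j} w_i w_j⟩
= (1/N_pf)⟨w(φ|U)²⟩_{q(φ|U)} + (N_pf − 1)/N_pf ≡ 1 + X(U)/N_pf`"; "Inserting back …
`ESS⁻¹(N_pf) = ∫dU q(U) w(U)² [1 + X(U)/N_pf] = ESS⁻¹(∞) + C'/N_pf`, where `ESS(∞)` is the
marginal ESS.  The result is identical to (ESSscalingNPF) up to algebraic manipulations and
redefinition of `C'`."

Lean reading (finite spaces, exact population moments — the paper's "asymptotically").  Gauge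
fields `U` and pseudofermion values `F` are `Fintype`s; the marginal model is a weight `q : U → ℝ`,
the gauge weight factor is `W U = p(U)/q(U)` (kept abstract), the conditional model is
`κ U : F → ℝ` with `Σ_f κ U f = 1`, the conditional weight `w U : F → ℝ` with `Σ_f κ U f · w U f = 1`
(this is "`⟨w⟩ = 1`"); the `N` independent draws are a tuple `g : Fin N → F` with the product
weight `iidWeight (κ U) g = Π_i κ U (g i)`.

Contents (all proved):
* `iidWeight`, `sum_iidWeight` (total mass one), `sum_iidWeight_mul_apply` (one-draw marginal:
  `⟨φ(w_i)⟩ = ⟨φ⟩`), `sum_iidWeight_mul_apply_mul_apply` (`⟨φ(w_i)ψ(w_j)⟩ = ⟨φ⟩⟨ψ⟩` for `i ≠ j` —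
  the independence used in App. A);
* `avgWeight w g = (Σ_i w (g i))/N` (eq. `condw`), `sum_iidWeight_mul_avgWeight` (its mean is
  `⟨w⟩`), and **`sum_iidWeight_mul_avgWeight_sq`** — App. A's
  `ε⁻¹_N(U) = 1 + X(U)/N`, `X(U) = ⟨w²⟩ − 1` (`condExcess`, non-negative: `condExcess_nonneg`);
* `essInvNpf q W κ w N = Σ_U q(U) ⟨(W(U) w_N)²⟩` — App. A's `ESS⁻¹(N_pf)` — and
  **`essInvNpf_eq`**: `ESS⁻¹(N) = Σ_U q W² + (Σ_U q W² X)/N = ESS⁻¹(∞) + C'/N`;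
  `firstMoment_npf` (the first moment of the weight is `Σ_U q W`, so with normalised weights
  `ESS = ⟨w⟩²/⟨w²⟩ = 1/essInvNpf`);
* **`ess_npf_law`** — the printed form `ESS(N_pf) = ESS(∞)/(1 + C/N_pf)` with
  `ESS(∞) = 1/Σ_U q W²` (the marginal ESS) and `C = C'·ESS(∞) ≥ 0` (`npfConstant_nonneg`);
* `essInvNpf_marginal_le` (`ESS(N_pf) ≤ ESS(∞)`: pseudofermion noise only lowers the ESS) and
  `essInvNpf_antitone` (more draws, larger ESS).

Context (cell pub-lqcd, HOME/R2-SCOPE.md §0 item 4, §3 E6, §4 C-PM): the "fitted C" of requirement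
E6 is the explicit population constant `C = (Σ_U q W² X)/(Σ_U q W²)`; the law is exact for the
population ESS, the fit concerns its finite-sample estimate.
-/

namespace Literature.Probability.ImportanceSampling

open Finset

/-! ## `N` independent draws from a finite conditional model -/

section IID

variable {F : Type*} [Fintype F] {N : ℕ}

/-- Probability weight of a tuple of `N` INDEPENDENT draws `g : Fin N → F` from the law `κ`:
`Π_i κ (g i)`. [cite: AbbottEtAl2022Fermions, App. A (the expectation
`⟨·⟩_{φ⁽¹⁾⋯φ⁽ᴺ⁾}` over `Π_i dφ⁽ⁱ⁾ q(φ⁽ⁱ⁾|U)`)] -/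
def iidWeight (κ : F → ℝ) (g : Fin N → F) : ℝ := ∏ i, κ (g i)

/-- The product law has total mass one. [cite: AbbottEtAl2022Fermions, App. A] -/
theorem sum_iidWeight {κ : F → ℝ} (hκ : ∑ f, κ f = 1) :
    ∑ g : Fin N → F, iidWeight κ g = 1 := by
  unfold iidWeight
  rw [← Fintype.prod_sum (fun (_ : Fin N) (f : F) => κ f)]
  simp [hκ]

/-- **One-draw marginal**: `⟨φ(φ⁽ⁱ⁾)⟩_{φ⁽¹⁾⋯φ⁽ᴺ⁾} = ⟨φ⟩_{q(·|U)}` — the other draws integrate to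
one. [cite: AbbottEtAl2022Fermions, App. A (the term `(1/N_pf)⟨w(φ|U)²⟩` of `ε⁻¹`)] -/
theorem sum_iidWeight_mul_apply {κ : F → ℝ} (hκ : ∑ f, κ f = 1) (φ : F → ℝ) (i : Fin N) :
    ∑ g : Fin N → F, iidWeight κ g * φ (g i) = ∑ f, κ f * φ f := by
  classical
  -- coordinate-dependent factors: `κ·φ` at coordinate `i`, `κ` elsewhere
  set b : Fin N → F → ℝ := fun j f => if j = i then κ f * φ f else κ f with hb
  have step1 : ∀ g : Fin N → F, iidWeight κ g * φ (g i) = ∏ j, b j (g j) := by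
    intro g
    unfold iidWeight
    rw [← mul_prod_erase univ (fun j => κ (g j)) (mem_univ i),
      ← mul_prod_erase univ (fun j => b j (g j)) (mem_univ i)]
    have h1 : b i (g i) = κ (g i) * φ (g i) := by simp [hb]
    have h2 : ∏ j ∈ univ.erase i, b j (g j) = ∏ j ∈ univ.erase i, κ (g j) :=
      prod_congr rfl fun j hj => by simp [hb, ne_of_mem_erase hj]
    rw [h1, h2]
    ring
  have step3 : ∏ j, ∑ f, b j f = ∑ f, κ f * φ f := by
    rw [← mul_prod_erase univ (fun j => ∑ f, b j f) (mem_univ i)]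
    have h1 : ∑ f, b i f = ∑ f, κ f * φ f := sum_congr rfl fun f _ => by simp [hb]
    have h2 : ∏ j ∈ univ.erase i, ∑ f, b j f = 1 :=
      prod_eq_one fun j hj => by simp [hb, ne_of_mem_erase hj, hκ]
    rw [h1, h2, mul_one]
  simp_rw [step1]
  rw [← Fintype.prod_sum b, step3]

/-- **Two-draw factorisation (independence)**: for `i ≠ j`,
`⟨φ(φ⁽ⁱ⁾) ψ(φ⁽ʲ⁾)⟩_{φ⁽¹⁾⋯φ⁽ᴺ⁾} = ⟨φ⟩⟨ψ⟩`. [cite: AbbottEtAl2022Fermions, App. A (the term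
`Σ_{i≠j} w_i w_j ↦ (N_pf − 1)/N_pf` of `ε⁻¹`, "Using ⟨w⟩ = 1")] -/
theorem sum_iidWeight_mul_apply_mul_apply {κ : F → ℝ} (hκ : ∑ f, κ f = 1) (φ ψ : F → ℝ)
    {i j : Fin N} (hij : i ≠ j) :
    ∑ g : Fin N → F, iidWeight κ g * (φ (g i) * ψ (g j)) =
      (∑ f, κ f * φ f) * (∑ f, κ f * ψ f) := by
  classical
  set b : Fin N → F → ℝ :=
    fun k f => if k = i then κ f * φ f else if k = j then κ f * ψ f else κ f with hb
  have hj : j ∈ univ.erase i := mem_erase.mpr ⟨hij.symm, mem_univ j⟩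
  have step1 : ∀ g : Fin N → F, iidWeight κ g * (φ (g i) * ψ (g j)) = ∏ k, b k (g k) := by
    intro g
    unfold iidWeight
    rw [← mul_prod_erase univ (fun k => κ (g k)) (mem_univ i),
      ← mul_prod_erase (univ.erase i) (fun k => κ (g k)) hj,
      ← mul_prod_erase univ (fun k => b k (g k)) (mem_univ i),
      ← mul_prod_erase (univ.erase i) (fun k => b k (g k)) hj]
    have h1 : b i (g i) = κ (g i) * φ (g i) := by simp [hb]
    have h2 : b j (g j) = κ (g j) * ψ (g j) := by simp [hb, hij.symm]
    have h3 : ∏ k ∈ (univ.erase i).erase j, b k (g k) = ∏ k ∈ (univ.erase i).erase j, κ (g k) :=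
      prod_congr rfl fun k hk => by
        have hkj : k ≠ j := ne_of_mem_erase hk
        have hki : k ≠ i := ne_of_mem_erase (mem_of_mem_erase hk)
        simp [hb, hkj, hki]
    rw [h1, h2, h3]
    ring
  have step3 : ∏ k, ∑ f, b k f = (∑ f, κ f * φ f) * (∑ f, κ f * ψ f) := by
    rw [← mul_prod_erase univ (fun k => ∑ f, b k f) (mem_univ i),
      ← mul_prod_erase (univ.erase i) (fun k => ∑ f, b k f) hj]
    have h1 : ∑ f, b i f = ∑ f, κ f * φ f := sum_congr rfl fun f _ => by simp [hb]
    have h2 : ∑ f, b j f = ∑ f, κ f * ψ f := sum_congr rfl fun f _ => by simp [hb, hij.symm]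
    have h3 : ∏ k ∈ (univ.erase i).erase j, ∑ f, b k f = 1 :=
      prod_eq_one fun k hk => by
        have hkj : k ≠ j := ne_of_mem_erase hk
        have hki : k ≠ i := ne_of_mem_erase (mem_of_mem_erase hk)
        simp [hb, hkj, hki, hκ]
    rw [h1, h2, h3, mul_one]
  simp_rw [step1]
  rw [← Fintype.prod_sum b, step3]

/-- The AVERAGED conditional weight of `N` draws,
`w_N({φ}|U) = (1/N) Σ_i w(φ⁽ⁱ⁾|U)`. [cite: AbbottEtAl2022Fermions, §III.E eq. (condw)
"w_{N_pf}({φ}|U) = (1/N_pf) Σ_{i=1}^{N_pf} p(φ⁽ⁱ⁾|U)/q(φ⁽ⁱ⁾|U)"] -/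
noncomputable def avgWeight (w : F → ℝ) (g : Fin N → F) : ℝ := (∑ i, w (g i)) / N

/-- The averaged weight has the same mean as one draw: `⟨w_N⟩ = ⟨w⟩` (`N ≥ 1`).
[cite: AbbottEtAl2022Fermions, §III.E ("more precise estimators of the determinant")] -/
theorem sum_iidWeight_mul_avgWeight {κ : F → ℝ} (hκ : ∑ f, κ f = 1) (hN : 0 < N) (w : F → ℝ) :
    ∑ g : Fin N → F, iidWeight κ g * avgWeight w g = ∑ f, κ f * w f := by
  have hN' : (N : ℝ) ≠ 0 := Nat.cast_ne_zero.mpr hN.ne'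
  unfold avgWeight
  simp_rw [mul_div_assoc', mul_sum]
  rw [← sum_div, sum_comm]
  simp_rw [sum_iidWeight_mul_apply hκ w]
  rw [sum_const, card_univ, Fintype.card_fin, nsmul_eq_mul]
  field_simp

/-- The conditional EXCESS second moment `X(U) = ⟨w(φ|U)²⟩_{q(φ|U)} − 1` (the conditional `χ²`
divergence when `⟨w⟩ = 1`). [cite: AbbottEtAl2022Fermions, App. A ("≡ 1 + X(U)/N_pf … we have
isolated the U and N_pf dependence")] -/
def condExcess (κ w : F → ℝ) : ℝ := (∑ f, κ f * w f ^ 2) - 1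

/-- `X(U) ≥ 0`: `⟨w²⟩ ≥ ⟨w⟩² = 1` (from `Σ κ (w − 1)² ≥ 0`). [cite: AbbottEtAl2022Fermions, App. A] -/
theorem condExcess_nonneg {κ w : F → ℝ} (hκ0 : ∀ f, 0 ≤ κ f) (hκ : ∑ f, κ f = 1)
    (hw : ∑ f, κ f * w f = 1) : 0 ≤ condExcess κ w := by
  unfold condExcess
  have h : 0 ≤ ∑ f, κ f * (w f - 1) ^ 2 := sum_nonneg fun f _ => mul_nonneg (hκ0 f) (sq_nonneg _)
  have h' : ∑ f, κ f * (w f - 1) ^ 2 = (∑ f, κ f * w f ^ 2) - 2 * (∑ f, κ f * w f) + ∑ f, κ f := by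
    simp_rw [show ∀ f, κ f * (w f - 1) ^ 2 = κ f * w f ^ 2 - 2 * (κ f * w f) + κ f from
      fun f => by ring, sum_add_distrib, sum_sub_distrib, mul_sum]
  rw [h', hw, hκ] at h
  linarith

/-- **App. A's conditional second moment**: with `⟨w⟩ = 1` and `N ≥ 1` independent draws,
`ε⁻¹_N(U) = ⟨w_N({φ}|U)²⟩ = (1/N)⟨w²⟩ + (N − 1)/N = 1 + X(U)/N`.
[cite: AbbottEtAl2022Fermions, App. A (the display for `ε⁻¹_{N_pf}(U)`:
"(1/N_pf²)⟨Σ_i w_i² + Σ_{i≠j} w_i w_j⟩ = (1/N_pf)⟨w(φ|U)²⟩ + (N_pf − 1)/N_pf ≡ 1 + X(U)/N_pf")] -/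
theorem sum_iidWeight_mul_avgWeight_sq {κ : F → ℝ} (hκ : ∑ f, κ f = 1) (hN : 0 < N) {w : F → ℝ}
    (hw : ∑ f, κ f * w f = 1) :
    ∑ g : Fin N → F, iidWeight κ g * avgWeight w g ^ 2 = 1 + condExcess κ w / N := by
  classical
  have hN' : (N : ℝ) ≠ 0 := Nat.cast_ne_zero.mpr hN.ne'
  set s : ℝ := ∑ f, κ f * w f ^ 2 with hs
  -- expand the square and exchange the sums
  have expand : ∀ g : Fin N → F, iidWeight κ g * avgWeight w g ^ 2 =
      (∑ i, ∑ j, iidWeight κ g * (w (g i) * w (g j))) / (N : ℝ) ^ 2 := by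
    intro g
    unfold avgWeight
    rw [div_pow, sq, sum_mul_sum, mul_div_assoc', mul_sum]
    simp_rw [mul_sum]
  simp_rw [expand]
  rw [← sum_div, sum_comm]
  -- inner moments: `⟨w_i w_j⟩ = s` if `i = j`, `= 1` if `i ≠ j`
  have inner : ∀ i : Fin N, ∑ g : Fin N → F, ∑ j, iidWeight κ g * (w (g i) * w (g j)) =
      s + ((N : ℝ) - 1) := by
    intro i
    rw [sum_comm, ← add_sum_erase _ _ (mem_univ i)]
    congr 1
    · rw [hs, ← sum_iidWeight_mul_apply hκ (fun f => w f ^ 2) i]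
      exact sum_congr rfl fun g _ => by ring
    · rw [sum_congr rfl fun j hj => sum_iidWeight_mul_apply_mul_apply hκ w w
        (ne_of_mem_erase hj).symm, hw, mul_one, sum_const, card_erase_of_mem (mem_univ i),
        card_univ, Fintype.card_fin, nsmul_eq_mul, mul_one, Nat.cast_pred hN]
  simp_rw [inner]
  rw [sum_const, card_univ, Fintype.card_fin, nsmul_eq_mul, condExcess, ← hs]
  field_simp
  ring

end IID

/-! ## Assembly over gauge fields: the `N_pf` law -/

section ESS

variable {U F : Type*} [Fintype U] [Fintype F]

/-- `ESS⁻¹(N_pf)`: the second moment of the total weight `w_{N_pf}(U) = W(U)·w_N({φ}|U)` under the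
joint model `q(U)·Π_i q(φ⁽ⁱ⁾|U)`. [cite: AbbottEtAl2022Fermions, App. A (first display:
"ESS⁻¹(N_pf) = ⟨w(U,{φ})²⟩_{q(U,{φ})} ≡ ∫dU q(U) w(U)² ε⁻¹_{N_pf}(U)"); §III.E (the definition
of `w_{N_pf}(U)`)] -/
noncomputable def essInvNpf (q W : U → ℝ) (κ w : U → F → ℝ) (N : ℕ) : ℝ :=
  ∑ u, q u * ∑ g : Fin N → F, iidWeight (κ u) g * (W u * avgWeight (w u) g) ^ 2

/-- The FIRST moment of the total weight is `Σ_U q(U) W(U)` (`= 1` for normalised `p/q`), so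
the asymptotic `ESS = ⟨w⟩²/⟨w²⟩` of the paper is `1/essInvNpf` for normalised weights.
[cite: AbbottEtAl2022Fermions, §III.A eq. (ESSgeneral) and §III.E eq. (ESS(N_pf))] -/
theorem firstMoment_npf {q W : U → ℝ} {κ w : U → F → ℝ} (hκ : ∀ u, ∑ f, κ u f = 1)
    (hw : ∀ u, ∑ f, κ u f * w u f = 1) {N : ℕ} (hN : 0 < N) :
    ∑ u, q u * ∑ g : Fin N → F, iidWeight (κ u) g * (W u * avgWeight (w u) g) =
      ∑ u, q u * W u := by
  refine sum_congr rfl fun u _ => ?_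
  simp_rw [mul_left_comm _ (W u), ← mul_sum]
  rw [sum_iidWeight_mul_avgWeight (hκ u) hN, hw u, mul_one]

/-- **App. A's law**: `ESS⁻¹(N_pf) = Σ_U q W² + (Σ_U q W² X)/N_pf = ESS⁻¹(∞) + C'/N_pf`, with
`ESS⁻¹(∞) = Σ_U q(U) W(U)²` the marginal model's inverse ESS and `C' = Σ_U q(U) W(U)² X(U)`.
[cite: AbbottEtAl2022Fermions, App. A (last display: "ESS⁻¹(N_pf) = ∫dU q(U) w(U)² [1 + X(U)/N_pf]
= ESS⁻¹(∞) + C'/N_pf, where ESS(∞) is the marginal ESS")] -/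
theorem essInvNpf_eq {q W : U → ℝ} {κ w : U → F → ℝ} (hκ : ∀ u, ∑ f, κ u f = 1)
    (hw : ∀ u, ∑ f, κ u f * w u f = 1) {N : ℕ} (hN : 0 < N) :
    essInvNpf q W κ w N =
      (∑ u, q u * W u ^ 2) + (∑ u, q u * W u ^ 2 * condExcess (κ u) (w u)) / N := by
  unfold essInvNpf
  have hu : ∀ u, ∑ g : Fin N → F, iidWeight (κ u) g * (W u * avgWeight (w u) g) ^ 2 =
      W u ^ 2 * (1 + condExcess (κ u) (w u) / N) := by
    intro u
    rw [← sum_iidWeight_mul_avgWeight_sq (hκ u) hN (hw u), mul_sum]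
    exact sum_congr rfl fun g _ => by ring
  simp_rw [hu]
  rw [show ∑ u, q u * (W u ^ 2 * (1 + condExcess (κ u) (w u) / (N : ℝ))) =
      ∑ u, (q u * W u ^ 2 + q u * W u ^ 2 * condExcess (κ u) (w u) / (N : ℝ)) from
    sum_congr rfl fun u _ => by ring, sum_add_distrib, sum_div]

/-- The printed constant `C = C'·ESS(∞) = (Σ_U q W² X)/(Σ_U q W²)`.
[cite: AbbottEtAl2022Fermions, §III.E eq. (ESSscalingNPF) ("where C is a constant"); App. A
("up to algebraic manipulations and redefinition of C'")] -/
noncomputable def npfConstant (q W : U → ℝ) (κ w : U → F → ℝ) : ℝ :=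
  (∑ u, q u * W u ^ 2 * condExcess (κ u) (w u)) / ∑ u, q u * W u ^ 2

/-- `C' ≥ 0` (hence `C ≥ 0`) for non-negative model weights. [cite: AbbottEtAl2022Fermions,
App. A] -/
theorem npfConstant'_nonneg {q W : U → ℝ} {κ w : U → F → ℝ} (hq : ∀ u, 0 ≤ q u)
    (hκ0 : ∀ u f, 0 ≤ κ u f) (hκ : ∀ u, ∑ f, κ u f = 1) (hw : ∀ u, ∑ f, κ u f * w u f = 1) :
    0 ≤ ∑ u, q u * W u ^ 2 * condExcess (κ u) (w u) :=
  sum_nonneg fun u _ => mul_nonneg (mul_nonneg (hq u) (sq_nonneg _))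
    (condExcess_nonneg (hκ0 u) (hκ u) (hw u))

/-- `C ≥ 0`. [cite: AbbottEtAl2022Fermions, §III.E eq. (ESSscalingNPF)] -/
theorem npfConstant_nonneg {q W : U → ℝ} {κ w : U → F → ℝ} (hq : ∀ u, 0 ≤ q u)
    (hκ0 : ∀ u f, 0 ≤ κ u f) (hκ : ∀ u, ∑ f, κ u f = 1) (hw : ∀ u, ∑ f, κ u f * w u f = 1) :
    0 ≤ npfConstant q W κ w :=
  div_nonneg (npfConstant'_nonneg hq hκ0 hκ hw)
    (sum_nonneg fun u _ => mul_nonneg (hq u) (sq_nonneg _))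

/-- **The `N_pf` law in its printed form**: `ESS(N_pf) = ESS(∞) / (1 + C/N_pf)` with
`ESS(∞) = 1/Σ_U q W²` the marginal ESS ("ESS(∞) coincides with the marginal ESS") and
`C = npfConstant`.  Here `ESS(N_pf) = 1/ESS⁻¹(N_pf)` (normalised weights, `firstMoment_npf`).
[cite: AbbottEtAl2022Fermions, §III.E eq. (ESSscalingNPF)] -/
theorem ess_npf_law {q W : U → ℝ} {κ w : U → F → ℝ} (hκ : ∀ u, ∑ f, κ u f = 1)
    (hw : ∀ u, ∑ f, κ u f * w u f = 1) (hpos : 0 < ∑ u, q u * W u ^ 2) {N : ℕ} (hN : 0 < N) :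
    (essInvNpf q W κ w N)⁻¹ = (∑ u, q u * W u ^ 2)⁻¹ / (1 + npfConstant q W κ w / N) := by
  have hN' : (N : ℝ) ≠ 0 := Nat.cast_ne_zero.mpr hN.ne'
  rw [essInvNpf_eq hκ hw hN, npfConstant]
  set A := ∑ u, q u * W u ^ 2
  set C' := ∑ u, q u * W u ^ 2 * condExcess (κ u) (w u)
  have hA : A ≠ 0 := hpos.ne'
  rw [show A + C' / N = A * (1 + C' / A / N) by field_simp, mul_inv, div_eq_mul_inv A⁻¹]

/-- **Pseudofermion noise only lowers the ESS**: `ESS⁻¹(N_pf) ≥ ESS⁻¹(∞)`, i.e.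
`ESS(N_pf) ≤ ESS(∞)` = the marginal (exact-determinant) model's ESS, for every `N_pf ≥ 1`.
[cite: AbbottEtAl2022Fermions, §III.E ("In the limit of infinitely many pseudofermion samples,
this converges to using the marginal flow model with an exact evaluation of the determinant")] -/
theorem essInvNpf_marginal_le {q W : U → ℝ} {κ w : U → F → ℝ} (hq : ∀ u, 0 ≤ q u)
    (hκ0 : ∀ u f, 0 ≤ κ u f) (hκ : ∀ u, ∑ f, κ u f = 1) (hw : ∀ u, ∑ f, κ u f * w u f = 1)
    {N : ℕ} (hN : 0 < N) :
    ∑ u, q u * W u ^ 2 ≤ essInvNpf q W κ w N := by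
  rw [essInvNpf_eq hκ hw hN]
  exact le_add_of_nonneg_right (div_nonneg (npfConstant'_nonneg hq hκ0 hκ hw) (Nat.cast_nonneg N))

/-- **More draws, larger ESS**: `N ≤ N' ⇒ ESS⁻¹(N') ≤ ESS⁻¹(N)` ("drawing more pseudofermion
samples … leads to higher acceptance rates"). [cite: AbbottEtAl2022Fermions, §III.E] -/
theorem essInvNpf_antitone {q W : U → ℝ} {κ w : U → F → ℝ} (hq : ∀ u, 0 ≤ q u)
    (hκ0 : ∀ u f, 0 ≤ κ u f) (hκ : ∀ u, ∑ f, κ u f = 1) (hw : ∀ u, ∑ f, κ u f * w u f = 1)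
    {N N' : ℕ} (hN : 0 < N) (hNN' : N ≤ N') :
    essInvNpf q W κ w N' ≤ essInvNpf q W κ w N := by
  have hN'pos : 0 < N' := lt_of_lt_of_le hN hNN'
  rw [essInvNpf_eq hκ hw hN, essInvNpf_eq hκ hw hN'pos]
  exact add_le_add le_rfl (div_le_div_of_nonneg_left (npfConstant'_nonneg hq hκ0 hκ hw)
    (Nat.cast_pos.mpr hN) (Nat.cast_le.mpr hNN'))

end ESS

end Literature.Probability.ImportanceSampling
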